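import Mathlib
import HarnessLib
import Summits.NavierStokesRegularity.NavierStokesRegularity.Theorems.TaylorModelRungThreeReadoutFlowVDiff

/-!
# Line `taylor-model` on crux K1b-DR (stmt-NavierStokesRegularity-23954) — (E) flow-side consumer of the vector
# step, part 3: (F4′) SEGMENT DERIVATIVES of the selector flow on the κ-tube, bounded by `L·dd·ω`

Continuation of `…ReadoutFlowVDiff`.  K1b-DR's LIP clause asks, for states `z, z'` κ-close to a tube point and
`dd`-close to each other (window ω-gauge), that `σ ↦ φ j (z' + σ•(z − z')) i k t'` be differentiable on `[0,1]` with
derivative bounded by a flow-Lipschitz constant times `dd·ω`.  Here, per sub-step and with the certificate clauses as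
explicit cascade-coordinate hypotheses: the κ-difference test (D1κ) puts every restart trajectory in the tube box, the
UNIT-ω variational test (V1) on that box (with `Ball_j(1) ⊆ [loV,hiV]`) scales to the direction `z − z'`
(`roughEnclosureV_smul`), the variation exists ALONG the restart trajectory (`exists_var_sol_mem_Icc_along`), and
`hasDerivWithinAt_flow_initial` (C¹ dependence on the initial condition, no step restriction) identifies it as the
σ-derivative; the row bound `max |loV| |hiV| ≤ L·ω` gives `|∂_σ φ| ≤ L·dd·ω`.

* `segDeriv_liftFlowSel_restart` — the (F4′) clause of `IsFlowPackageV` for one sub-step.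

MODEL-lattice rung TL-M3 only; nothing here is a statement about the Navier–Stokes equations.
-/

noncomputable section

-- the sub-problem namespace repeats the summit name by design (D-0017)
set_option linter.dupNamespace false

namespace Summit.NavierStokesRegularity.NavierStokesRegularity.Theorems.TaylorModelReadout

open Set Finset
open Literature.Analysis.FluidPDE.TaoCascade Literature.Analysis.FluidPDE.TaoCascade.TaylorChain
open Summit.NavierStokesRegularity.NavierStokesRegularity.Theorems.TaylorModelMajorant
open Summit.NavierStokesRegularity.NavierStokesRegularity.Theorems.TaylorModelVector

variable {cd : CertData} {j : ℕ} {tlo thi loK hiK loV hiV w z z' : Fin 4 → ℤ → ℝ} {h u₀ dd L : ℝ}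

/-- A point of the segment between two states of the κ-ball around a base point is in the κ-ball. [folklore] -/
theorem inBall_segment {base : Fin 4 → ℤ → ℝ} (hz : cd.InBall j (z - base) (cd.κ j))
    (hz' : cd.InBall j (z' - base) (cd.κ j)) {σ : ℝ} (hσ : σ ∈ Icc (0:ℝ) 1) :
    cd.InBall j (z' + σ • (z - z') - base) (cd.κ j) := by
  intro i k hk1 hk2
  have h1 := hz i k hk1 hk2
  have h2 := hz' i k hk1 hk2
  have e : (z' + σ • (z - z') - base) i k = (1 - σ) * (z' - base) i k + σ * (z - base) i k := by
    simp only [Pi.add_apply, Pi.sub_apply, Pi.smul_apply, smul_eq_mul]; ring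
  rw [e]
  calc |(1 - σ) * (z' - base) i k + σ * (z - base) i k|
      ≤ |(1 - σ) * (z' - base) i k| + |σ * (z - base) i k| := abs_add_le _ _
    _ = (1 - σ) * |(z' - base) i k| + σ * |(z - base) i k| := by
        rw [abs_mul, abs_mul, abs_of_nonneg (by linarith [hσ.2]), abs_of_nonneg hσ.1]
    _ ≤ (1 - σ) * (cd.κ j * cd.ω j k) + σ * (cd.κ j * cd.ω j k) := by
        gcongr
        · linarith [hσ.2]
        · exact hσ.1
    _ = cd.κ j * cd.ω j k := by ring

/-- **(F4′) segment derivatives on the κ-tube.** Along a tube trajectory from `w` (selector flow solving on `[0,h]`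
with window bounds in `[tlo,thi]`), for states `z, z'` κ-close to its point at time `u₀` with `z − z' ∈ Ball_j(dd)`:
for every window coordinate and every `t' ∈ [0, h − u₀]`, `σ ↦ φ j (z' + σ•(z−z')) i k t'` has a derivative within
`[0,1]` bounded by `L·dd·ω j k` — given the κ-difference test over the tube box (with `Ball_j(κ) ⊆ [loK,hiK]`), the
unit-ω variational test over the box `[tlo+loK, thi+hiK]` (with `Ball_j(1) ⊆ [loV,hiV]`) and the row bound
`max |loV| |hiV| ≤ L·ω`. [folklore] -/
theorem segDeriv_liftFlowSel_restart
    (hMS : IsMajorantSystem (nW cd) (Qw cd) (wW cd j) (cd.bb j) (taylorJet (Qw cd)) (varJet (Qw cd)))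
    (hω : ∀ k, 0 < cd.ω j k) (hu₀ : u₀ ∈ Icc 0 h)
    (hw : SolvesOn cd (fun _ => liftFlow cd (fun x s => flowSel (Qw cd) x s)) j w h)
    (htube : ∀ u ∈ Icc 0 h, ∀ i k, -cd.Kb ≤ k → k ≤ cd.Ka →
      tlo i k ≤ stAt (fun _ => liftFlow cd (fun x s => flowSel (Qw cd) x s)) j w u i k ∧
        stAt (fun _ => liftFlow cd (fun x s => flowSel (Qw cd) x s)) j w u i k ≤ thi i k)
    (hKκ : ∀ i k, -cd.Kb ≤ k → k ≤ cd.Ka → loK i k ≤ -(cd.κ j * cd.ω j k) ∧ cd.κ j * cd.ω j k ≤ hiK i k)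
    (hencK : ∀ d₀ : Fin 4 → ℤ → ℝ, cd.InBall j d₀ (cd.κ j) → ∀ y d : Fin 4 → ℤ → ℝ,
      (∀ i k, -cd.Kb ≤ k → k ≤ cd.Ka → tlo i k ≤ y i k ∧ y i k ≤ thi i k) →
      (∀ i k, -cd.Kb ≤ k → k ≤ cd.Ka → loK i k ≤ d i k ∧ d i k ≤ hiK i k) → ∀ u ∈ Icc (0:ℝ) h,
        ∀ i k, -cd.Kb ≤ k → k ≤ cd.Ka →
          loK i k ≤ (d₀ + u • (cd.Qb y d + cd.Qb d y + cd.Qb d d)) i k ∧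
          (d₀ + u • (cd.Qb y d + cd.Qb d y + cd.Qb d d)) i k ≤ hiK i k)
    (hVunit : ∀ i k, -cd.Kb ≤ k → k ≤ cd.Ka → loV i k ≤ -cd.ω j k ∧ cd.ω j k ≤ hiV i k)
    (hencV : ∀ v₀ : Fin 4 → ℤ → ℝ, cd.InBall j v₀ 1 → ∀ y v : Fin 4 → ℤ → ℝ,
      (∀ i k, -cd.Kb ≤ k → k ≤ cd.Ka → (tlo + loK) i k ≤ y i k ∧ y i k ≤ (thi + hiK) i k) →
      (∀ i k, -cd.Kb ≤ k → k ≤ cd.Ka → loV i k ≤ v i k ∧ v i k ≤ hiV i k) → ∀ u ∈ Icc (0:ℝ) h,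
        ∀ i k, -cd.Kb ≤ k → k ≤ cd.Ka →
          loV i k ≤ (v₀ + u • (cd.Qb y v + cd.Qb v y)) i k ∧ (v₀ + u • (cd.Qb y v + cd.Qb v y)) i k ≤ hiV i k)
    (hL : ∀ i k, -cd.Kb ≤ k → k ≤ cd.Ka → max |loV i k| |hiV i k| ≤ L * cd.ω j k)
    (hz : cd.InBall j (z - stAt (fun _ => liftFlow cd (fun x s => flowSel (Qw cd) x s)) j w u₀) (cd.κ j))
    (hz' : cd.InBall j (z' - stAt (fun _ => liftFlow cd (fun x s => flowSel (Qw cd) x s)) j w u₀) (cd.κ j))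
    (hdd : cd.InBall j (z - z') dd) :
    ∀ i k, -cd.Kb ≤ k → k ≤ cd.Ka → ∀ t' ∈ Icc 0 (h - u₀), ∃ ψ : ℝ → ℝ, ∀ σ ∈ Icc (0:ℝ) 1,
      HasDerivWithinAt (fun σ' : ℝ => liftFlow cd (fun x s => flowSel (Qw cd) x s) (z' + σ' • (z - z')) i k t')
        (ψ σ) (Icc 0 1) σ ∧ |ψ σ| ≤ L * dd * cd.ω j k := by
  obtain ⟨Qb, hQb⟩ := exists_bundle hMS
  intro i k hk1 hk2 t' ht'
  have hk : -cd.Kb ≤ k ∧ k ≤ cd.Ka := ⟨hk1, hk2⟩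
  set c : Fin (nW cd) := eW cd (i, ⟨k, Finset.mem_Icc.2 hk⟩) with hc
  -- the tube trajectory in window coordinates
  have hwsol := isSolOn_flowSel_of_solvesOn hw
  have htube' : ∀ s ∈ Icc 0 h, flowSel (Qw cd) (toVec cd w) s ∈ Icc (toVec cd tlo) (toVec cd thi) := by
    intro s hs
    have h1 := toVec_mem_Icc_of_bounds (cd := cd) (htube s hs)
    rwa [stAt_liftFlow, toVec_ofVec] at h1
  set base : Fin 4 → ℤ → ℝ := stAt (fun _ => liftFlow cd (fun x s => flowSel (Qw cd) x s)) j w u₀ with hbase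
  have hbase' : base = ofVec cd (flowSel (Qw cd) (toVec cd w) u₀) := by rw [hbase, stAt_liftFlow]
  -- every segment point is κ-close, so its trajectory exists on `[0, h-u₀]` with difference in the κ-box
  have hseg : ∀ σ ∈ Icc (0:ℝ) 1,
      IsSolOn (Qw cd) (toVec cd (z' + σ • (z - z'))) (h - u₀)
          (fun s => flowSel (Qw cd) (toVec cd (z' + σ • (z - z'))) s) ∧
        ∀ s ∈ Icc 0 (h - u₀), flowSel (Qw cd) (toVec cd (z' + σ • (z - z'))) s -
          flowSel (Qw cd) (toVec cd w) (u₀ + s) ∈ Icc (toVec cd loK) (toVec cd hiK) := by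
    intro σ hσ
    have hzσ : cd.InBall j (z' + σ • (z - z') - ofVec cd (flowSel (Qw cd) (toVec cd w) u₀)) (cd.κ j) := by
      rw [← hbase']; exact inBall_segment hz hz' hσ
    exact exists_restart_flowSel hMS hu₀ hwsol htube' hzσ hKκ hencK
  -- the family of trajectories from the segment, on `[0, t']`, bounded
  have ht'h : Icc 0 t' ⊆ Icc 0 (h - u₀) := Icc_subset_Icc_right ht'.2
  set R : ℝ := max ‖toVec cd (tlo + loK)‖ ‖toVec cd (thi + hiK)‖ with hR
  have hfamBox : ∀ σ ∈ Icc (0:ℝ) 1, ∀ s ∈ Icc 0 (h - u₀),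
      flowSel (Qw cd) (toVec cd z' + σ • toVec cd (z - z')) s ∈
        Icc (toVec cd (tlo + loK)) (toVec cd (thi + hiK)) := by
    intro σ hσ s hs
    have h1 := (hseg σ hσ).2 s hs
    have h2 := htube' (u₀ + s) ⟨by linarith [hu₀.1, hs.1], by linarith [hs.2]⟩
    rw [toVec_add, toVec_smul] at h1
    rw [toVec_add, toVec_add]
    constructor
    · intro c'; have a := h1.1 c'; have b := h2.1 c'
      simp only [Pi.add_apply, Pi.sub_apply] at a b ⊢; linarith
    · intro c'; have a := h1.2 c'; have b := h2.2 c'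
      simp only [Pi.add_apply, Pi.sub_apply] at a b ⊢; linarith
  -- the direction and its unit-ω scaling
  have hddnn : 0 ≤ dd := by
    have h1 := hdd i k hk1 hk2
    have h2 := hω k
    nlinarith [abs_nonneg ((z - z') i k)]
  set v : Fin (nW cd) → ℝ := toVec cd (z - z') with hv
  obtain ⟨vhat, hvhat1, hvdd⟩ : ∃ vhat : Fin (nW cd) → ℝ, (∀ c', |vhat c'| ≤ 1 * wW cd j c') ∧ v = dd • vhat := by
    rcases eq_or_lt_of_le hddnn with h0 | hpos
    · refine ⟨0, fun c' => by simpa using (wW_pos cd hω c').le, ?_⟩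
      funext c'
      have h1 := hdd (modeOf cd c') (shellOf cd c') (shellOf_mem cd c').1 (shellOf_mem cd c').2
      rw [← h0, zero_mul] at h1
      have h2 : (z - z') (modeOf cd c') (shellOf cd c') = 0 := abs_nonpos_iff.1 h1
      show toVec cd (z - z') c' = (dd • (0 : Fin (nW cd) → ℝ)) c'
      rw [Pi.smul_apply, Pi.zero_apply, smul_zero]
      exact h2
    · refine ⟨dd⁻¹ • v, fun c' => ?_, by rw [smul_smul, mul_inv_cancel₀ hpos.ne', one_smul]⟩
      have h1 := hdd (modeOf cd c') (shellOf cd c') (shellOf_mem cd c').1 (shellOf_mem cd c').2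
      rw [Pi.smul_apply, smul_eq_mul, abs_mul, abs_of_pos (inv_pos.2 hpos), one_mul]
      rw [inv_mul_le_iff₀ hpos]
      simpa [hv, toVec, wW] using h1
  -- the scaled variational test along trajectories in the tube ⊕ κ box
  have hencV1 : ∀ yv ∈ Icc (toVec cd (tlo + loK)) (toVec cd (thi + hiK)), ∀ vv ∈ Icc (toVec cd loV) (toVec cd hiV),
      ∀ u ∈ Icc (0:ℝ) h, vhat + u • (Qb yv vv + Qb vv yv) ∈ Icc (toVec cd loV) (toVec cd hiV) := by
    intro yv hyv vv hvv u hu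
    have h1 := hencV (ofVec cd vhat) ((inBall_ofVec_iff cd j vhat 1).2 hvhat1) (ofVec cd yv) (ofVec cd vv)
      (ofVec_window_bounds (cd := cd) hyv) (ofVec_window_bounds (cd := cd) hvv) u hu
    have h2 := toVec_mem_Icc_of_bounds (cd := cd) h1
    rw [toVec_add, toVec_smul, toVec_add, toVec_ofVec] at h2
    simpa [hQb, Qw] using h2
  have hencVdd := roughEnclosureV_smul Qb hencV1 hddnn
  rw [← hvdd] at hencVdd
  have hvhatmem : vhat ∈ Icc (toVec cd loV) (toVec cd hiV) := by
    refine ⟨fun c' => ?_, fun c' => ?_⟩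
    · have a := (abs_le.1 (hvhat1 c')).1
      have b := (hVunit (modeOf cd c') (shellOf cd c') (shellOf_mem cd c').1 (shellOf_mem cd c').2).1
      simp only [toVec, wW, one_mul] at a b ⊢; linarith
    · have a := (abs_le.1 (hvhat1 c')).2
      have b := (hVunit (modeOf cd c') (shellOf cd c') (shellOf_mem cd c').1 (shellOf_mem cd c').2).2
      simp only [toVec, wW, one_mul] at a b ⊢; linarith
  have hvmem : v ∈ Icc (dd • toVec cd loV) (dd • toVec cd hiV) := hvdd ▸ smul_mem_Icc_smul hvhatmem hddnn
  -- for each σ: the variation from `v` along the σ-trajectory exists on `[0,t']` inside `dd • [loV,hiV]`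
  have hvar : ∀ σ ∈ Icc (0:ℝ) 1, ∃ V : ℝ → Fin (nW cd) → ℝ, V 0 = v ∧
      (∀ s ∈ Icc 0 t', HasDerivWithinAt V
        (Qb (flowSel (Qw cd) (toVec cd z' + σ • toVec cd (z - z')) s) (V s) +
          Qb (V s) (flowSel (Qw cd) (toVec cd z' + σ • toVec cd (z - z')) s)) (Icc 0 t') s) ∧
      ∀ s ∈ Icc 0 t', V s ∈ Icc (dd • toVec cd loV) (dd • toVec cd hiV) := by
    intro σ hσ
    have hsol := isSolOn_restrict (hseg σ hσ).1 ht'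
    rw [toVec_add, toVec_smul] at hsol
    have hcont : ContinuousOn (fun s => flowSel (Qw cd) (toVec cd z' + σ • toVec cd (z - z')) s) (Icc 0 t') :=
      fun s hs => (hsol.2 s hs).continuousWithinAt
    exact exists_var_sol_mem_Icc_along Qb ht'.1 hcont (fun s hs => hfamBox σ hσ s (ht'h hs)) hvmem
      (fun y hy vv hvv u hu => hencVdd y hy vv hvv u ⟨hu.1, hu.2.trans (ht'.2.trans (by linarith [hu₀.1]))⟩)
  -- the σ-derivative: choose the variation at each σ
  classical
  refine ⟨fun σ => if hσ : σ ∈ Icc (0:ℝ) 1 then (Classical.choose (hvar σ hσ)) t' c else 0, fun σ hσ => ?_⟩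
  obtain ⟨hV0, hVder, hVbox⟩ := Classical.choose_spec (hvar σ hσ)
  set V := Classical.choose (hvar σ hσ) with hVdef
  simp only [dif_pos hσ]
  constructor
  · -- C¹ dependence on the initial condition along the segment
    have hmain := hasDerivWithinAt_flow_initial Qb (x := toVec cd z') (v := v) (t := t') (R := R) ht'.1
      (Θ := Icc (0:ℝ) 1) hσ (ψ := fun θ s => flowSel (Qw cd) (toVec cd z' + θ • toVec cd (z - z')) s)
      (fun θ _ => flowSel_zero _) ?_ ?_ hV0 hVder
    · have hcomp := (hasDerivWithinAt_pi.1 hmain) c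
      refine hcomp.congr (fun σ' _ => ?_) ?_
      · show liftFlow cd (fun x s => flowSel (Qw cd) x s) (z' + σ' • (z - z')) i k t' =
          flowSel (Qw cd) (toVec cd z' + σ' • toVec cd (z - z')) t' c
        rw [liftFlow_of_mem _ i hk, toVec_add, toVec_smul]
      · show liftFlow cd (fun x s => flowSel (Qw cd) x s) (z' + σ • (z - z')) i k t' =
          flowSel (Qw cd) (toVec cd z' + σ • toVec cd (z - z')) t' c
        rw [liftFlow_of_mem _ i hk, toVec_add, toVec_smul]
    · intro θ hθ s hs
      have h1 := (isSolOn_restrict (hseg θ hθ).1 ht').2 s hs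
      rw [toVec_add, toVec_smul] at h1
      simpa only [hQb] using h1
    · intro θ hθ s hs
      exact norm_le_of_mem_Icc (hfamBox θ hθ s (ht'h hs))
  · -- the bound from the scaled variation box and the row bound
    have hmem := hVbox t' ⟨ht'.1, le_rfl⟩
    have h1 := hmem.1 c
    have h2 := hmem.2 c
    have h3 := hL i k hk1 hk2
    simp only [Pi.smul_apply, smul_eq_mul, toVec, hc, modeOf, shellOf, Equiv.symm_apply_apply] at h1 h2
    rw [abs_le]
    have h4 : |loV i k| ≤ L * cd.ω j k := (le_max_left _ _).trans h3
    have h5 : |hiV i k| ≤ L * cd.ω j k := (le_max_right _ _).trans h3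
    have h6 := neg_abs_le (loV i k)
    have h7 := le_abs_self (hiV i k)
    constructor <;> nlinarith

end Summit.NavierStokesRegularity.NavierStokesRegularity.Theorems.TaylorModelReadout

end
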